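import Summits.CriticalPhenomena.PercolationContinuityZ3.Theorems.Transplant.FKConnectivityAllQForestRayleighK4
import Summits.CriticalPhenomena.PercolationContinuityZ3.Theorems.Transplant.FKConnectivityAllQFastEvalBridgeGen
import Summits.CriticalPhenomena.PercolationContinuityZ3.Theorems.Transplant.FKConnectivityAllQForestAdjacentHeredity
import HarnessLib

/-!
# `AdjForestRayleighNoSqOn (Fin 4)` — the square-free adjacent forest Rayleigh node HOLDS on four vertices, ALL fibres (kernel certificate)

Support file (`--supports stmt-CriticalPhenomena-4575`), FK sub-lane `prim-bschramm-fk-1` (gen 18) of the post-continuity programme;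
builds on p205010 (kernel theorem, internal audit signed; external expert review pending).  Definitions = computable Boolean indicators
only (no new objects), no named facts, no sorries; standard axioms (`decide +kernel` on the verified fast evaluator of `…FastEval*.lean`, four
chunks of < 10 s; no `native_decide`).

THE NODE `AdjForestRayleighNoSqOn V` (`…TwoClusterRayleighNoSq.lean`) quantifies over ALL fibres `(M, u₀)` of the vertex type `V` — i.e. over
all multigraph minors, not only over simple graphs.  This file proves it for `V = Fin 4`, hence (heredity, `…ForestAdjacentHeredity.lean`) for
`Fin n`, every `n ≤ 4`: **`adjForestRayleighNoSqOn_fin_four`**, **`adjForestRayleighNoSqOn_fin_le_four`**.  It is the first complete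
(all-fibre) certified case of the open node; the method is the general one and is written to be re-instantiated:
1. WLOG `(o, v, y) = (0, 1, 2)`: transport of fibre counts along a permutation of the vertices (`fibreCount_image` of
   `…ForestAdjacentNoSqArrow.lean`; the permutation exists by `decide`), the degenerate triples `o = v` / `o = y` being vacuous (a forest
   contains no loop) — `exists_perm`, `fin_four_of_core`, `core`;
2. fibres containing a loop are vacuous (`fibreCount_forest_eq_zero_of_diag`);
3. every loop-free pair `(M, u₀)` of disjoint configurations of `Fin 4` is a pair of masks `(μ, υ)` over the six listed pairs of `k4D`
   (`…ForestRayleighK4.lean`) with `μ AND υ = 0` (`exists_mask`, `land_eq_zero_of_disjoint`);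
4. the general mask bridge (`fibreCount_conf_tOf_eq_card_bool`, `…FastEvalBridgeGen.lean`) turns both counts into binary-split sums of the
   Boolean indicators `gBad / gGood` (read through `forestB_iff` and `not_beq_land_two_pow_iff`);
5. ONE Boolean `rowsOK d b` (a binary-split conjunction over `μ ∈ [b, b + 2^d)`, all `υ < 64`) is evaluated by `decide +kernel` in four
   chunks of 16 rows (`rows_0 … rows_3`), and unfolded back to the cell inequality (`cell_of_rowsOK`).
Exhaustive numerics of this generation (memo bschramm/FROM-fk-1-g18-VERTEX-NC.md §3): the node holds on `Fin n` for every `n ≤ 11`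
(1.05·10⁹ instances); the kernel now has `n ≤ 4`.
[cite: SempleWelsh2008, Conj. 1.1 (p. 2); Thm. 4.2 (p. 11)] [cite: CibulkaHladkyLaCroixWagner2008, Thm. 1 (p. 2)] [cite: Linusson2011, Prop. 2.6]
[cite: Grimmett2006, §1.5 (p. 13)]
-/

namespace Summit.CriticalPhenomena.PercolationContinuityZ3.Theorems

namespace FK

open Set Literature.Probability.LatticeModels Literature.Probability.Percolation
open scoped symmDiff

namespace ForestFinFour

open RCEval ForestRayleighK4

/-! ### The Boolean indicators and the kernel evaluation (listed pairs of `k4D`: `0 = 01, 1 = 23, 2 = 02, 3 = 03, 4 = 12, 5 = 13`) -/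

/-- "bad" cell indicator: `a ⊆ μ`, `e = 01, f = 02 ∈ υ ∪ a`, `υ ∪ a` and `υ ∪ (μ ∖ a)` forests. [cite: Linusson2011, Prop. 2.6] -/
def gBad (μ υ a : ℕ) : Bool :=
  Nat.beq (Nat.land a μ) a && ((!(Nat.beq (Nat.land (Nat.lor υ a) (2 ^ 0)) 0)) && ((!(Nat.beq (Nat.land (Nat.lor υ a) (2 ^ 2)) 0)) &&
    (k4D.forestB (Nat.lor υ a) && k4D.forestB (Nat.lor υ (Nat.xor μ a)))))

/-- "good" cell indicator: `a ⊆ μ`, `e ∈ υ ∪ a`, `f ∈ υ ∪ (μ ∖ a)`, both forests. [cite: Linusson2011, Prop. 2.6] -/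
def gGood (μ υ a : ℕ) : Bool :=
  Nat.beq (Nat.land a μ) a && ((!(Nat.beq (Nat.land (Nat.lor υ a) (2 ^ 0)) 0)) &&
    ((!(Nat.beq (Nat.land (Nat.lor υ (Nat.xor μ a)) (2 ^ 2)) 0)) && (k4D.forestB (Nat.lor υ a) && k4D.forestB (Nat.lor υ (Nat.xor μ a)))))

/-- The cell `(μ, υ)` passes: the masks meet, or `bad ≤ good`. [folklore] -/
def cellOK (μ υ : ℕ) : Bool :=
  (!(Nat.beq (Nat.land μ υ) 0)) ||
    Nat.ble (sumR (fun a => if gBad μ υ a = true then 1 else 0) 6 0) (sumR (fun a => if gGood μ υ a = true then 1 else 0) 6 0)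

/-- Rows `μ ∈ [b, b + 2^d)` against all `υ < 64`, as a binary-split conjunction. [folklore] -/
def rowsOK : ℕ → ℕ → Bool
  | 0, b => Nat.beq (sumR (fun υ => if cellOK b υ = true then 0 else 1) 6 0) 0
  | d + 1, b => rowsOK d b && rowsOK d (b + 2 ^ d)

/-- Rows `0–15`. (this file's `decide +kernel` evaluation) -/
theorem rows_0 : rowsOK 4 0 = true := by decide +kernel

/-- Rows `16–31`. (this file's `decide +kernel` evaluation) -/
theorem rows_1 : rowsOK 4 16 = true := by decide +kernel

/-- Rows `32–47`. (this file's `decide +kernel` evaluation) -/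
theorem rows_2 : rowsOK 4 32 = true := by decide +kernel

/-- Rows `48–63`. (this file's `decide +kernel` evaluation) -/
theorem rows_3 : rowsOK 4 48 = true := by decide +kernel

/-- Unfolding `rowsOK`: every cell of the covered rows passes. [folklore] -/
theorem cell_of_rowsOK : ∀ (d b : ℕ), rowsOK d b = true → ∀ μ, b ≤ μ → μ < b + 2 ^ d → ∀ υ, υ < 64 → cellOK μ υ = true := by
  intro d
  induction d with
  | zero =>
    intro b h μ hb hμ υ hυ
    have hμb : μ = b := by omega
    subst hμb
    unfold rowsOK at h
    rw [Nat.beq_eq, sumR_eq, Finset.sum_eq_zero_iff] at h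
    have h' := h υ (Finset.mem_range.2 (by norm_num; exact hυ))
    rw [zero_add] at h'
    by_contra hc
    rw [if_neg hc] at h'
    exact one_ne_zero h'
  | succ d ih =>
    intro b h μ hb hμ υ hυ
    unfold rowsOK at h
    rw [Bool.and_eq_true] at h
    by_cases hlt : μ < b + 2 ^ d
    · exact ih b h.1 μ hb hlt υ hυ
    · exact ih (b + 2 ^ d) h.2 μ (by omega) (by rw [pow_succ] at hμ; omega) υ hυ

/-- **All 4096 cells pass.** [cite: Linusson2011, Prop. 2.6] -/
theorem cell_all {μ υ : ℕ} (hμ : μ < 64) (hυ : υ < 64) : cellOK μ υ = true := by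
  by_cases h1 : μ < 16
  · exact cell_of_rowsOK 4 0 rows_0 μ (Nat.zero_le _) (by norm_num; exact h1) υ hυ
  by_cases h2 : μ < 32
  · exact cell_of_rowsOK 4 16 rows_1 μ (by omega) (by norm_num; exact h2) υ hυ
  by_cases h3 : μ < 48
  · exact cell_of_rowsOK 4 32 rows_2 μ (by omega) (by norm_num; exact h3) υ hυ
  · exact cell_of_rowsOK 4 48 rows_3 μ (by omega) (by norm_num; exact hμ) υ hυ

/-! ### Reading the indicators -/

/-- Pair `2` is `f = 02`. [folklore] -/
theorem edge_two : k4D.edge 2 = s((0 : Fin 4), 2) := by decide +kernel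

/-- Every genuine pair of `Fin 4` is listed. [folklore] -/
theorem edge_surj : ∀ p : Sym2 (Fin 4), ¬ p.IsDiag → ∃ i : Fin 6, k4D.edge i = p := by decide +kernel

/-- `e = 01` lies in the configuration of the mask `x` iff bit `0` of `x` is set. [folklore] -/
theorem e_mem_iff (x : ℕ) : s((0 : Fin 4), 1) ∈ k4D.conf (k4D.tOf x) ↔ (!(Nat.beq (Nat.land x (2 ^ 0)) 0)) = true := by
  rw [not_beq_land_two_pow_iff, ← edge_zero, edge_mem_conf valid, mem_tOf]
  exact Iff.rfl

/-- `f = 02` lies in the configuration of the mask `x` iff bit `2` of `x` is set. [folklore] -/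
theorem f_mem_iff (x : ℕ) : s((0 : Fin 4), 2) ∈ k4D.conf (k4D.tOf x) ↔ (!(Nat.beq (Nat.land x (2 ^ 2)) 0)) = true := by
  rw [not_beq_land_two_pow_iff, ← edge_two, edge_mem_conf valid, mem_tOf]
  exact Iff.rfl

/-- `forestB` reads `IsForestCfg`. [cite: Grimmett2006, §1.5 (p. 13)] -/
theorem forestB_iff' (x : ℕ) : k4D.forestB x = true ↔ IsForestCfg (k4D.conf (k4D.tOf x)) := forestB_iff (D := k4D) x valid noloop

/-- The "bad" predicate of the bridge is `gBad`. [cite: Linusson2011, Prop. 2.6] -/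
theorem bad_iff (μ υ a : ℕ) :
    (Nat.land a μ = a ∧ k4D.conf (k4D.tOf (Nat.lor υ a)) ∈ forestEv (Fin 4) ∩ {ω | s((0 : Fin 4), 1) ∈ ω ∧ s((0 : Fin 4), 2) ∈ ω} ∧
        k4D.conf (k4D.tOf (Nat.lor υ (Nat.xor μ a))) ∈ forestEv (Fin 4)) ↔ gBad μ υ a = true := by
  rw [gBad, Bool.and_eq_true, Bool.and_eq_true, Bool.and_eq_true, Bool.and_eq_true, Nat.beq_eq, ← e_mem_iff, ← f_mem_iff,
    forestB_iff', forestB_iff', mem_inter_iff, mem_setOf_eq]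
  show _ ∧ (IsForestCfg _ ∧ _) ∧ IsForestCfg _ ↔ _
  tauto

/-- The "good" predicate of the bridge is `gGood`. [cite: Linusson2011, Prop. 2.6] -/
theorem good_iff (μ υ a : ℕ) :
    (Nat.land a μ = a ∧ k4D.conf (k4D.tOf (Nat.lor υ a)) ∈ forestEv (Fin 4) ∩ {ω | s((0 : Fin 4), 1) ∈ ω} ∧
        k4D.conf (k4D.tOf (Nat.lor υ (Nat.xor μ a))) ∈ forestEv (Fin 4) ∩ {ω | s((0 : Fin 4), 2) ∈ ω}) ↔ gGood μ υ a = true := by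
  rw [gGood, Bool.and_eq_true, Bool.and_eq_true, Bool.and_eq_true, Bool.and_eq_true, Nat.beq_eq, ← e_mem_iff, ← f_mem_iff,
    forestB_iff', forestB_iff', mem_inter_iff, mem_setOf_eq, mem_inter_iff, mem_setOf_eq]
  show _ ∧ (IsForestCfg _ ∧ _) ∧ (IsForestCfg _ ∧ _) ↔ _
  tauto

/-! ### Every loop-free fibre of `Fin 4` is a pair of masks -/

/-- A loop-free configuration of `Fin 4` is the configuration of a mask `< 64`. [folklore] -/
theorem exists_mask (X : BondConfig (Fin 4)) (hX : ∀ p ∈ X, ¬ p.IsDiag) : ∃ μ : ℕ, μ < 2 ^ 6 ∧ k4D.conf (k4D.tOf μ) = X := by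
  classical
  set T : Finset (Fin 6) := Finset.univ.filter fun i => k4D.edge i ∈ X with hT
  refine ⟨k4D.maskOf T, maskOf_lt fun i _ => (mem_firstT k4D.m i).2 i.is_lt, ?_⟩
  rw [tOf_maskOf]
  ext p
  unfold RCEval.conf
  rw [Finset.mem_coe, Finset.mem_image]
  constructor
  · rintro ⟨i, hi, rfl⟩
    exact (Finset.mem_filter.1 hi).2
  · intro hp
    obtain ⟨i, hi⟩ := edge_surj p (hX p hp)
    exact ⟨i, Finset.mem_filter.2 ⟨Finset.mem_univ _, hi ▸ hp⟩, hi⟩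

/-- Disjoint configurations have masks (below `2⁶`) without a common bit. [folklore] -/
theorem land_eq_zero_of_disjoint {μ υ : ℕ} (hμ : μ < 2 ^ 6) (h : Disjoint (k4D.conf (k4D.tOf υ)) (k4D.conf (k4D.tOf μ))) :
    Nat.land μ υ = 0 := by
  by_contra hne
  obtain ⟨j, hμj, hυj⟩ := (land_ne_zero_iff μ υ).1 hne
  have hj : j < 6 := by
    by_contra hj
    have hlt : μ < 2 ^ j := lt_of_lt_of_le hμ (Nat.pow_le_pow_right (by norm_num) (not_lt.1 hj))
    rw [Nat.testBit_eq_false_of_lt hlt] at hμj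
    exact Bool.false_ne_true hμj
  have hμ' : k4D.edge ⟨j, hj⟩ ∈ k4D.conf (k4D.tOf μ) := (edge_mem_conf valid _ _).2 ((mem_tOf μ ⟨j, hj⟩).2 hμj)
  have hυ' : k4D.edge ⟨j, hj⟩ ∈ k4D.conf (k4D.tOf υ) := (edge_mem_conf valid _ _).2 ((mem_tOf υ ⟨j, hj⟩).2 hυj)
  exact Set.disjoint_left.1 h hυ' hμ'

/-! ### Vacuous fibres and the core inequality at `(o, v, y) = (0, 1, 2)` -/

/-- A fibre `(M, u)` containing a loop carries no pair of forests. [cite: Grimmett2006, §1.5 (p. 13)] -/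
theorem fibreCount_forest_eq_zero_of_diag {V : Type*} [Fintype V] {M u : BondConfig V} {p : Sym2 V} (hp : p.IsDiag) (hpM : p ∈ M ∪ u)
    (A B : Set (BondConfig V)) : fibreCount M u (forestEv V ∩ A) (forestEv V ∩ B) = 0 := by
  classical
  refine fibreCount_eq_zero_of_forall M u _ _ fun ω hω hA hB => ?_
  rcases hpM with hpM | hpu
  · by_cases hpω : p ∈ ω
    · exact hA.1.1 p hpω hp
    · exact hB.1.1 p (Set.mem_symmDiff.2 (Or.inr ⟨hpM, hpω⟩)) hp
  · have : p ∈ ω := by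
      have h' : p ∈ ω \ M := hω.symm ▸ hpu
      exact h'.1
    exact hA.1.1 p this hp

/-- **The core**: for every fibre `(M, u₀)` of `Fin 4`, `#(Fo ∩ {01, 02 ∈ ω}, Fo) ≤ #(Fo ∩ {01 ∈ ω}, Fo ∩ {02 ∈ ω})`.
[cite: SempleWelsh2008, Conj. 1.1 (p. 2)] [cite: Linusson2011, Prop. 2.6] -/
theorem core (M u₀ : BondConfig (Fin 4)) (hd : Disjoint u₀ M) :
    fibreCount M u₀ (forestEv (Fin 4) ∩ {ω | s((0 : Fin 4), 1) ∈ ω ∧ s((0 : Fin 4), 2) ∈ ω}) (forestEv (Fin 4)) ≤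
      fibreCount M u₀ (forestEv (Fin 4) ∩ {ω | s((0 : Fin 4), 1) ∈ ω}) (forestEv (Fin 4) ∩ {ω | s((0 : Fin 4), 2) ∈ ω}) := by
  classical
  by_cases hdiag : ∃ p ∈ M ∪ u₀, Sym2.IsDiag p
  · obtain ⟨p, hpM, hp⟩ := hdiag
    have h0 := fibreCount_forest_eq_zero_of_diag hp hpM {ω | s((0 : Fin 4), 1) ∈ ω ∧ s((0 : Fin 4), 2) ∈ ω} (univ : Set (BondConfig (Fin 4)))
    rw [inter_univ] at h0
    rw [h0]; exact Nat.zero_le _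
  · have hdiag' : ∀ p ∈ M ∪ u₀, ¬ Sym2.IsDiag p := fun p hp hpd => hdiag ⟨p, hp, hpd⟩
    obtain ⟨μ, hμ, rfl⟩ := exists_mask M fun p hp => hdiag' p (Or.inl hp)
    obtain ⟨υ, hυ, rfl⟩ := exists_mask u₀ fun p hp => hdiag' p (Or.inr hp)
    have hland : Nat.land μ υ = 0 := land_eq_zero_of_disjoint hμ hd
    rw [fibreCount_conf_tOf_eq_card_bool valid hland (gBad μ υ) (fun a _ => bad_iff μ υ a),
      fibreCount_conf_tOf_eq_card_bool valid hland (gGood μ υ) (fun a _ => good_iff μ υ a),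
      card_filter_range_eq_sumR, card_filter_range_eq_sumR]
    have hc := cell_all hμ hυ
    unfold cellOK at hc
    rw [Bool.or_eq_true] at hc
    rcases hc with hc | hc
    · rw [hland] at hc
      exact absurd hc (by decide)
    · exact Nat.le_of_ble_eq_true hc

/-! ### WLOG `(o, v, y) = (0, 1, 2)`: transport along a permutation -/

/-- A permutation sending three distinct vertices of `Fin 4` to `0, 1, 2`. [folklore] -/
theorem exists_perm : ∀ o v y : Fin 4, o ≠ v → o ≠ y → v ≠ y → ∃ σ : Equiv.Perm (Fin 4), σ o = 0 ∧ σ v = 1 ∧ σ y = 2 := by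
  decide

/-- The node's inequality at `(o, v, y)` from the core at `(0, 1, 2)`. [cite: SempleWelsh2008, Conj. 1.1 (p. 2)] [cite: Linusson2011, Prop. 2.6] -/
theorem fin_four_of_core (M u₀ : BondConfig (Fin 4)) (hd : Disjoint u₀ M) (o v y : Fin 4) (hvy : v ≠ y) :
    fibreCount M u₀ (forestEv (Fin 4) ∩ {ω | s(o, v) ∈ ω ∧ s(o, y) ∈ ω}) (forestEv (Fin 4)) ≤
      fibreCount M u₀ (forestEv (Fin 4) ∩ {ω | s(o, v) ∈ ω}) (forestEv (Fin 4) ∩ {ω | s(o, y) ∈ ω}) := by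
  classical
  -- degenerate triples: a loop is never open in a forest
  by_cases hov : o = v
  · subst hov
    rw [fibreCount_eq_zero_of_forall M u₀ _ _ fun ω _ hA _ => hA.1.1 _ hA.2.1 (Sym2.mk_isDiag_iff.2 rfl)]
    exact Nat.zero_le _
  by_cases hoy : o = y
  · subst hoy
    rw [fibreCount_eq_zero_of_forall M u₀ _ _ fun ω _ hA _ => hA.1.1 _ hA.2.2 (Sym2.mk_isDiag_iff.2 rfl)]
    exact Nat.zero_le _
  obtain ⟨σ, ho, hv, hy⟩ := exists_perm o v y hov hoy hvy
  set j : Fin 4 ↪ Fin 4 := σ.toEmbedding with hj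
  have hjo : j o = 0 := ho
  have hjv : j v = 1 := hv
  have hjy : j y = 2 := hy
  have hFo : ∀ ω : BondConfig (Fin 4), Sym2.map j '' ω ∈ forestEv (Fin 4) ↔ ω ∈ forestEv (Fin 4) := fun ω => isForestCfg_image_iff j ω
  have hmem : ∀ (ω : BondConfig (Fin 4)) (a b : Fin 4), s(j a, j b) ∈ Sym2.map j '' ω ↔ s(a, b) ∈ ω := by
    intro ω a b
    rw [← Sym2.map_mk]
    exact (Sym2.map.injective j.injective).mem_set_image
  have e1 := fibreCount_image j M u₀
    (A := forestEv (Fin 4) ∩ {ω | s(o, v) ∈ ω ∧ s(o, y) ∈ ω}) (B := forestEv (Fin 4))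
    (A' := forestEv (Fin 4) ∩ {ω | s((0 : Fin 4), 1) ∈ ω ∧ s((0 : Fin 4), 2) ∈ ω}) (B' := forestEv (Fin 4))
    (fun ω => by rw [mem_inter_iff, mem_inter_iff, hFo, mem_setOf_eq, mem_setOf_eq, ← hjo, ← hjv, ← hjy, hmem, hmem]) hFo
  have e2 := fibreCount_image j M u₀
    (A := forestEv (Fin 4) ∩ {ω | s(o, v) ∈ ω}) (B := forestEv (Fin 4) ∩ {ω | s(o, y) ∈ ω})
    (A' := forestEv (Fin 4) ∩ {ω | s((0 : Fin 4), 1) ∈ ω}) (B' := forestEv (Fin 4) ∩ {ω | s((0 : Fin 4), 2) ∈ ω})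
    (fun ω => by rw [mem_inter_iff, mem_inter_iff, hFo, mem_setOf_eq, mem_setOf_eq, ← hjo, ← hjv, hmem])
    (fun ω => by rw [mem_inter_iff, mem_inter_iff, hFo, mem_setOf_eq, mem_setOf_eq, ← hjo, ← hjy, hmem])
  rw [← e1, ← e2]
  exact core _ _ ((Set.disjoint_image_iff (Sym2.map.injective j.injective)).2 hd)

end ForestFinFour

/-- **`AdjForestRayleighNoSqOn (Fin 4)`**: the square-free adjacent forest Rayleigh node holds on four vertices — every fibre, i.e. every
multigraph minor. [cite: SempleWelsh2008, Conj. 1.1 (p. 2); Thm. 4.2 (p. 11)] [cite: CibulkaHladkyLaCroixWagner2008, Thm. 1 (p. 2)]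
[cite: Linusson2011, Prop. 2.6] -/
theorem adjForestRayleighNoSqOn_fin_four : AdjForestRayleighNoSqOn (Fin 4) :=
  fun M u₀ hd o v y hvy => ForestFinFour.fin_four_of_core M u₀ hd o v y hvy

/-- **`AdjForestRayleighNoSqOn (Fin n)` for every `n ≤ 4`** (heredity). [cite: SempleWelsh2008, Conj. 1.1 (p. 2)] -/
theorem adjForestRayleighNoSqOn_fin_le_four {n : ℕ} (hn : n ≤ 4) : AdjForestRayleighNoSqOn (Fin n) :=
  adjForestRayleighNoSqOn_fin_mono hn adjForestRayleighNoSqOn_fin_four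

end FK

end Summit.CriticalPhenomena.PercolationContinuityZ3.Theorems
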